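import Summits.CriticalPhenomena.PercolationContinuityZ3.Theorems.PercNearOneGluingNoHeavyQuantFarHubFamilyStems
import Summits.CriticalPhenomena.PercolationContinuityZ3.Theorems.PercNearOneGluingNoHeavyQuantFarBlockTransfer
import HarnessLib

/-!
# QUANT lane R8, front "FAR beyond trees", layer one — HUB FAMILIES IV: **BLOCK-LOCALITY OF FAR(1) MODULO THE LAW-LEVEL DOMINATION**
# (an ARBITRARY pendant block with a family of hubs may be replaced by independent stems at its cut vertex as soon as its two internal numbers
# dominate a mixture of `(hProd, tProd)` and the exit point — the interface for 2-connected cores that are not cycles)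

builds on p205010 (kernel theorem, internal audit signed; external expert review pending)

Support file (`--supports stmt-CriticalPhenomena-4575`), seat `prim-quant-p1` (gen 22); memo
`run/shared/lean/prim/quant/prim-quant-p1-g22/FOR-LEAD-KHUB.md` §5–§6.  Standard axioms; no sorries.

Setting: `Block.IsHubFamily c Z J v S` (any core), `w` hanging `Z` at `c` and each `S j` at `v j`, block relays = anchors or hub vertices.
`Block.decChain c Z J v S A w` = the chain (`Block.mchain`) of the LOADED anchors with marginals `m_j = P_w(c ↔ v j in core)` and their hub laws.
* `Block.real_blockCount_fd_ge_one/two` — the hub-decoupled block (`Block.fdecouple`) has internal numbers `(hProd, tProd)` of `decChain`;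
* `Block.real_onReach_anchor_w/hub_w` — internal marginals of the TRUE block factor through the core: `P_w(c ↔ a on Z) = m_j · P_w(v j ↔ a inside)`;
  `Block.tip_le_mu_fd` — the least tip marginal `q` satisfies `q ≤ m_i u_i` on every loaded anchor; `Block.real_openConn_fdecouple_eq` — marginals kept;
* **`Block.real_card_le_one_le_hubFamily`**, **`Block.farLayerOne_hubFamily`** — IF for every admissible exit value `q` (`0 ≤ q ≤ m_i u_i` on the loaded
  anchors) the true numbers `(P_w(X ≥ 1), P_w(X ≥ 2))` dominate `λ·(hProd, tProd) + (1−λ)·(q, q)` for some `λ ∈ [0,1]` (hypothesis `hdom` — for pendant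
  CYCLES this is `TwoChain.cycDec` + `…QuantFarCycleBlockLaw`, giving `Block.farLayerOne_cycleBlock`), then the `j = 1` FAR instance transfers from the
  decoupled weights.  So FAR(1) block-locality for ANY pendant 2-connected core is reduced to that one law-level inequality (memo §5: numerically it holds
  on all cores tested; the (C)-route of the cycle proof does not always apply).
[cite: KozmaNitzan2024, Conjecture 3 (p. 15)] (the row); [this work].
-/

noncomputable section

namespace Summit.CriticalPhenomena.PercolationContinuityZ3.Theorems

namespace Quant

namespace Block

open Finset MeasureTheory Set
open Literature.Probability.LatticeModels
open Literature.Probability.Percolation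
open Bundle (offZ avoid real_offZ_event_eq_of_agree)
open TwoChain (hProd tProd)
open scoped Classical

variable {n : ℕ}

/-- The chain of the loaded anchors of a hub family: marginals `m_j = P_w(c ↔ v j in core)`, hub laws under `w`. [this work] -/
def decChain (c : Fin n) (Z : Finset (Fin n)) (J : Finset ℕ) (v : ℕ → Fin n) (S : ℕ → Finset (Fin n)) (A : Finset (Fin n))
    (w : Sym2 (Fin n) → unitInterval) : TwoChain :=
  mchain (fun j => (prodBernoulli w).real {ω | core Z (hubs J S) ω ∈ openConn c (v j)}) v S A w 0 (floadedList J v S A)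

/-- The pairs a family of hanging hubs must not use: `{x, y}` with `x ∈ S j`, `y ∉ S j ∪ {v j}`. [this work] -/
def hubForb (J : Finset ℕ) (v : ℕ → Fin n) (S : ℕ → Finset (Fin n)) : Finset (Sym2 (Fin n)) :=
  Finset.univ.filter fun e => ∃ j ∈ J, ∃ x y : Fin n, e = s(x, y) ∧ x ≠ y ∧ x ∈ S j ∧ y ∉ S j ∧ y ≠ v j

section Family

variable {c : Fin n} {Z : Finset (Fin n)} {J : Finset ℕ} {v : ℕ → Fin n} {S : ℕ → Finset (Fin n)} (H : IsHubFamily c Z J v S)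
  (w : Sym2 (Fin n) → unitInterval) (A : Finset (Fin n))
  (hangS : ∀ j ∈ J, ∀ x y : Fin n, x ≠ y → x ∈ S j → y ∉ S j → y ≠ v j → (w s(x, y) : ℝ) = 0)

/-! ## Almost-sure goodness of the hubs under `w` -/

include hangS in
/-- The forbidden hub pairs carry weight `0`. [this work] -/
theorem hubForb_vanish : ∀ e ∈ hubForb J v S, (w e : ℝ) = 0 := by
  intro e he
  obtain ⟨j, hj, x, y, rfl, hxy, hx, hy, hyv⟩ := (Finset.mem_filter.1 he).2
  exact hangS j hj x y hxy hx hy hyv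

omit H in
/-- Off the forbidden hub pairs every hub is good. [this work] -/
theorem hubsGood_of_forb {ω : BondConfig (Fin n)} (hω : ∀ e ∈ hubForb J v S, e ∉ ω) : ∀ j ∈ J, Good (v j) (S j) ω := by
  intro j hj x y hxy he hx hy
  by_contra hyv
  exact hω _ (Finset.mem_filter.2 ⟨Finset.mem_univ _, j, hj, x, y, rfl, hxy, hx, hy, hyv⟩) he

include hangS in
/-- Events agreeing on configurations good for every hub have the same probability. [this work] -/
theorem real_congr_hubs (U T : Set (BondConfig (Fin n))) (hUT : ∀ ω, (∀ j ∈ J, Good (v j) (S j) ω) → (ω ∈ U ↔ ω ∈ T)) :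
    (prodBernoulli w).real U = (prodBernoulli w).real T :=
  real_congr_of_vanish w (hubForb J v S) (hubForb_vanish w hangS) U T fun _ hω => hUT _ (hubsGood_of_forb hω)

/-! ## Core and hubs are independent under `w` -/

omit H in
/-- The core pairs avoid every hub's pairs. [this work] -/
theorem disjoint_corePairs_hubPairs {j : ℕ} (hj : j ∈ J) : Disjoint (corePairs Z (hubs J S)) (hubPairs (S j) (v j)) := by
  rw [Finset.disjoint_left]
  intro e he he'
  obtain ⟨⟨z, hz, hze⟩, -⟩ := (Finset.mem_filter.1 he').2
  exact (Finset.mem_filter.1 he).2.2 z (mem_hubs.2 ⟨j, hj, hz⟩) hze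

/-- A core event and an event read off a hub count are independent. [this work] -/
theorem real_core_inter_hubCount {j : ℕ} (hj : j ∈ J) (P : BondConfig (Fin n) → Prop) (Q : ℕ → Prop) :
    (prodBernoulli w).real ({ω | P (core Z (hubs J S) ω)} ∩ {ω | Q (hubCount v S A j ω)}) =
      (prodBernoulli w).real {ω | P (core Z (hubs J S) ω)} * (prodBernoulli w).real {ω | Q (hubCount v S A j ω)} :=
  prodBernoulli_real_inter_of_determinedBy_disjoint w (disjoint_corePairs_hubPairs hj) (determinedBy_core Z (hubs J S) P)
    ((readsOff_hubCount v S A j).determinedBy Q) (Set.toFinite _).measurableSet (Set.toFinite _).measurableSet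

/-- A core event and an event read off the inner pairs of a hub are independent. [this work] -/
theorem real_core_inter_inS {j : ℕ} (hj : j ∈ J) (P Q : BondConfig (Fin n) → Prop) :
    (prodBernoulli w).real ({ω | P (core Z (hubs J S) ω)} ∩ {ω | Q (inS (S j) (v j) ω)}) =
      (prodBernoulli w).real {ω | P (core Z (hubs J S) ω)} * (prodBernoulli w).real {ω | Q (inS (S j) (v j) ω)} :=
  prodBernoulli_real_inter_of_determinedBy_disjoint w (disjoint_corePairs_hubPairs hj) (determinedBy_core Z (hubs J S) P)
    (determinedBy_inS (S j) (v j) Q) (Set.toFinite _).measurableSet (Set.toFinite _).measurableSet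

include H hangS in
/-- Internal marginal of an anchor: `P_w(c ↔ v j on Z) = P_w(c ↔ v j in core)`. [this work] -/
theorem real_onReach_anchor_w {j : ℕ} (hj : j ∈ J) :
    (prodBernoulli w).real {ω | onZ Z ω ∈ openConn c (v j)} = (prodBernoulli w).real {ω | core Z (hubs J S) ω ∈ openConn c (v j)} :=
  real_congr_hubs w hangS _ _ fun ω hω => by
    simp only [mem_setOf_eq]
    rw [show (onZ Z ω ∈ openConn c (v j)) = (openGraph (onZ Z ω)).Reachable c (v j) from rfl,
      on_reach_iff_core_family H hω (fun i hi => H.vS j hj i hi)]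
    rfl

include H hangS in
/-- Internal marginal of a hub vertex: `P_w(c ↔ a on Z) = P_w(c ↔ v j in core) · P_w(v j ↔ a inside)` for `a ∈ S j`. [this work] -/
theorem real_onReach_hub_w {j : ℕ} (hj : j ∈ J) {a : Fin n} (ha : a ∈ S j) :
    (prodBernoulli w).real {ω | onZ Z ω ∈ openConn c a} =
      (prodBernoulli w).real {ω | core Z (hubs J S) ω ∈ openConn c (v j)} * (prodBernoulli w).real {ω | inS (S j) (v j) ω ∈ openConn (v j) a} := by
  rw [← real_core_inter_inS w hj (fun η => η ∈ openConn c (v j)) (fun η => η ∈ openConn (v j) a)]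
  exact real_congr_hubs w hangS _ _ fun ω hω => by
    simp only [mem_setOf_eq, Set.mem_inter_iff]
    rw [show (onZ Z ω ∈ openConn c a) = (openGraph (onZ Z ω)).Reachable c a from rfl, on_reach_hub_iff_family H hω hj ha]
    rfl

/-! ## The numbers of the decoupled block and the exit point -/

include H in
/-- `P_{w'}(X ≥ 1) = hProd` and `P_{w'}(X ≥ 2) = tProd` of `decChain`, for the hub-decoupled weights. [this work] -/
theorem real_blockCount_fd (hA : ∀ a ∈ A ∩ Z, ∃ j ∈ J, a = v j ∨ a ∈ S j) :
    (prodBernoulli (fdecouple c Z J v S w)).real {ω | 1 ≤ ((A ∩ Z).filter fun a => onZ Z ω ∈ openConn c a).card} =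
        hProd (floadedList J v S A).length (decChain c Z J v S A w) ∧
      (prodBernoulli (fdecouple c Z J v S w)).real {ω | 2 ≤ ((A ∩ Z).filter fun a => onZ Z ω ∈ openConn c a).card} =
        tProd (floadedList J v S A).length (decChain c Z J v S A w) := by
  have h := real_fstemCountL H w A (floadedList J v S A) 0 (fun p hp => (mem_floadedList.1 hp).1) (floadedList_nodup J v S A)
  constructor
  · rw [real_card_on_eq_stemCountF H w hA (fun k => 1 ≤ k)]
    have e : {ω : BondConfig (Fin n) | 1 ≤ stemCountF c J v S A ω} = {ω | 1 ≤ fstemCountL c v S A (floadedList J v S A) ω} := by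
      ext ω; simp only [mem_setOf_eq, stemCountF_eq_fstemCountL]
    rw [e]; exact h.1
  · rw [real_card_on_eq_stemCountF H w hA (fun k => 2 ≤ k)]
    have e : {ω : BondConfig (Fin n) | 2 ≤ stemCountF c J v S A ω} = {ω | 2 ≤ fstemCountL c v S A (floadedList J v S A) ω} := by
      ext ω; simp only [mem_setOf_eq, stemCountF_eq_fstemCountL]
    rw [e]; exact h.2

include H hangS in
/-- **The least internal tip marginal is an admissible exit value**: `q ≤ P_w(c ↔ a on Z)` on the block relays gives `q ≤ m_i u_i` on every loaded
anchor of `decChain`. [this work] -/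
theorem tip_le_mu_fd (q : ℝ) (hq : ∀ a ∈ A ∩ Z, q ≤ (prodBernoulli w).real {ω | onZ Z ω ∈ openConn c a}) :
    ∀ i, i < (floadedList J v S A).length → q ≤ (decChain c Z J v S A w).m (i + 1) * (decChain c Z J v S A w).u (i + 1) := by
  intro i hi
  set ps := floadedList J v S A with hpsdef
  set p := ps[i] with hpdef
  have hpmem : p ∈ ps := List.getElem_mem hi
  have hp : p ∈ J := (mem_floadedList.1 hpmem).1
  have hload : Loaded v S A p := (mem_floadedList.1 hpmem).2
  have hpos : lpos 0 0 ps (i + 1) = p := lpos_of_lt_length hi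
  have hm : (decChain c Z J v S A w).m (i + 1) = (prodBernoulli w).real {ω | core Z (hubs J S) ω ∈ openConn c (v p)} := by
    unfold decChain; rw [mchain_m, hpos]
  have hu : (decChain c Z J v S A w).u (i + 1) = (prodBernoulli w).real {ω | 1 ≤ hubCount v S A p ω} := by
    simp only [decChain, TwoChain.u, mchain]; rw [← hpsdef, hpos, real_hubCount_ge_one]
  rw [hm, hu]
  rcases hload with ⟨a, ha⟩ | hcp
  · have haZ : a ∈ A ∩ Z := Finset.mem_inter.2 ⟨(Finset.mem_inter.1 ha).1, H.SZ p hp (Finset.mem_inter.1 ha).2⟩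
    refine (hq a haZ).trans ?_
    rw [real_onReach_hub_w H w hangS hp (Finset.mem_inter.1 ha).2, ← real_core_inter_hubCount w A hp (fun η => η ∈ openConn c (v p)) (fun k => 1 ≤ k),
      ← real_core_inter_inS w hp (fun η => η ∈ openConn c (v p)) (fun η => η ∈ openConn (v p) a)]
    refine measureReal_mono (fun ω hω => ⟨hω.1, ?_⟩)
    simp only [mem_setOf_eq, hubCount]
    have : 0 < ((A ∩ S p).filter fun a' => inS (S p) (v p) ω ∈ openConn (v p) a').card := Finset.card_pos.2 ⟨a, Finset.mem_filter.2 ⟨ha, hω.2⟩⟩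
    omega
  · have haZ : v p ∈ A ∩ Z := Finset.mem_inter.2 ⟨hcp, H.vZ p hp⟩
    refine (hq (v p) haZ).trans ?_
    rw [real_onReach_anchor_w H w hangS hp]
    have h1 : (prodBernoulli w).real {ω | 1 ≤ hubCount v S A p ω} = 1 := by
      have : {ω : BondConfig (Fin n) | 1 ≤ hubCount v S A p ω} = Set.univ := by
        ext ω; simp only [mem_setOf_eq, Set.mem_univ, iff_true, hubCount, if_pos hcp]; omega
      rw [this, probReal_univ]
    rw [h1, mul_one]

/-! ## The transfer theorem modulo domination -/

include H hangS in
/-- **BLOCK-LOCALITY OF FAR(1) MODULO DOMINATION.**  If for every admissible exit value `q` the true internal numbers dominate a mixture of the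
decoupled numbers `(hProd, tProd)` of `decChain` and `(q, q)`, then for the hub-decoupled weights `w'`: `P_{w'}(N ≤ 1) ≤ t` and `P_w(o ↮ a) ≤ t` on the
block relays imply `P_w(N ≤ 1) ≤ t`. [this work] -/
theorem real_card_le_one_le_hubFamily (hangZ : ∀ x y : Fin n, x ≠ y → x ∈ Z → y ∉ Z → y ≠ c → (w s(x, y) : ℝ) = 0)
    (hA : ∀ a ∈ A ∩ Z, ∃ j ∈ J, a = v j ∨ a ∈ S j) {o : Fin n} (ho : o ∉ Z) (hAZ : (A ∩ Z).Nonempty) (t : ℝ)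
    (hdom : ∀ q : ℝ, 0 ≤ q → (∀ i, i < (floadedList J v S A).length → q ≤ (decChain c Z J v S A w).m (i + 1) * (decChain c Z J v S A w).u (i + 1)) →
      ∃ l : ℝ, 0 ≤ l ∧ l ≤ 1 ∧
        l * hProd (floadedList J v S A).length (decChain c Z J v S A w) + (1 - l) * q ≤
          (prodBernoulli w).real {ω | 1 ≤ ((A ∩ Z).filter fun a => onZ Z ω ∈ openConn c a).card} ∧
        l * tProd (floadedList J v S A).length (decChain c Z J v S A w) + (1 - l) * q ≤
          (prodBernoulli w).real {ω | 2 ≤ ((A ∩ Z).filter fun a => onZ Z ω ∈ openConn c a).card})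
    (hcut : ∀ a ∈ A ∩ Z, (prodBernoulli w).real (openConn o a)ᶜ ≤ t)
    (hfar' : (prodBernoulli (fdecouple c Z J v S w)).real {ω : BondConfig (Fin n) | (A.filter fun a => ω ∈ openConn o a).card ≤ 1} ≤ t) :
    (prodBernoulli w).real {ω : BondConfig (Fin n) | (A.filter fun a => ω ∈ openConn o a).card ≤ 1} ≤ t := by
  set τ : Fin n → ℝ := fun a => (prodBernoulli w).real {ω | onZ Z ω ∈ openConn c a} with hτ
  obtain ⟨a₀, ha₀, hmin⟩ := (A ∩ Z).exists_min_image τ hAZ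
  set q := τ a₀ with hq
  obtain ⟨lam, hlam0, hlam1, hdomh, hdomt⟩ := hdom q measureReal_nonneg (tip_le_mu_fd H w A hangS q hmin)
  obtain ⟨e1, e2⟩ := real_blockCount_fd H w A hA
  refine real_card_le_one_le_of_dominates w (fdecouple c Z J v S w) ho H.cZ hangZ (fdecouple_hangZ H w)
    (fun e he => (fdecouple_of_avoid w he).symm) A t q lam hlam0 hlam1 measureReal_le_one ha₀ le_rfl (hcut a₀ ha₀) ?_ ?_ hfar'
  · rw [e1]; exact hdomh
  · rw [e2]; exact hdomt

include H hangS in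
/-- **Hub-decoupling preserves the marginals of the relays.** [this work] -/
theorem real_openConn_fdecouple_eq (hangZ : ∀ x y : Fin n, x ≠ y → x ∈ Z → y ∉ Z → y ≠ c → (w s(x, y) : ℝ) = 0)
    (hA : ∀ a ∈ A ∩ Z, ∃ j ∈ J, a = v j ∨ a ∈ S j) {o : Fin n} (ho : o ∉ Z) {a : Fin n} (ha : a ∈ A) :
    (prodBernoulli (fdecouple c Z J v S w)).real (openConn o a) = (prodBernoulli w).real (openConn o a) := by
  set w' := fdecouple c Z J v S w with hw'
  have hagree : ∀ e ∈ avoid Z, w e = w' e := fun e he => (fdecouple_of_avoid w he).symm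
  by_cases haZ : a ∈ Z
  · rw [real_openConn_in_eq w' ho H.cZ (fdecouple_hangZ H w) haZ, real_openConn_in_eq w ho H.cZ hangZ haZ,
      ← real_offZ_event_eq_of_agree w w' Z hagree (fun η => η ∈ openConn o c)]
    congr 1
    obtain ⟨j, hj, hja⟩ := hA a (Finset.mem_inter.2 ⟨ha, haZ⟩)
    rcases hja with rfl | haS
    · rw [real_onReach_anchor_fd H w hj, real_onReach_anchor_w H w hangS hj]
    · rw [real_onReach_hub_fd H w hj haS, real_onReach_hub_w H w hangS hj haS]
  · rw [real_openConn_off_eq (c := c) w' ho (fdecouple_hangZ H w) haZ, real_openConn_off_eq (c := c) w ho hangZ haZ,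
      ← real_offZ_event_eq_of_agree w w' Z hagree (fun η => η ∈ openConn o a)]

include H hangS in
/-- **The layer-one FAR instance transfers from the hub-decoupled weights, modulo domination.** [this work] -/
theorem farLayerOne_hubFamily (hangZ : ∀ x y : Fin n, x ≠ y → x ∈ Z → y ∉ Z → y ≠ c → (w s(x, y) : ℝ) = 0)
    (hA : ∀ a ∈ A ∩ Z, ∃ j ∈ J, a = v j ∨ a ∈ S j) {o : Fin n} (ho : o ∉ Z) (hAZ : (A ∩ Z).Nonempty) (t : ℝ)
    (hdom : ∀ q : ℝ, 0 ≤ q → (∀ i, i < (floadedList J v S A).length → q ≤ (decChain c Z J v S A w).m (i + 1) * (decChain c Z J v S A w).u (i + 1)) →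
      ∃ l : ℝ, 0 ≤ l ∧ l ≤ 1 ∧
        l * hProd (floadedList J v S A).length (decChain c Z J v S A w) + (1 - l) * q ≤
          (prodBernoulli w).real {ω | 1 ≤ ((A ∩ Z).filter fun a => onZ Z ω ∈ openConn c a).card} ∧
        l * tProd (floadedList J v S A).length (decChain c Z J v S A w) + (1 - l) * q ≤
          (prodBernoulli w).real {ω | 2 ≤ ((A ∩ Z).filter fun a => onZ Z ω ∈ openConn c a).card})
    (hfar' : (2 : ℝ) < ∑ a ∈ A, (prodBernoulli (fdecouple c Z J v S w)).real (openConn o a) →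
      (∀ a ∈ A, (prodBernoulli (fdecouple c Z J v S w)).real (openConn o a)ᶜ ≤ t) →
      (prodBernoulli (fdecouple c Z J v S w)).real {ω : BondConfig (Fin n) | (A.filter fun a => ω ∈ openConn o a).card ≤ 1} ≤ t)
    (hsum : (2 : ℝ) < ∑ a ∈ A, (prodBernoulli w).real (openConn o a))
    (hcut : ∀ a ∈ A, (prodBernoulli w).real (openConn o a)ᶜ ≤ t) :
    (prodBernoulli w).real {ω : BondConfig (Fin n) | (A.filter fun a => ω ∈ openConn o a).card ≤ 1} ≤ t := by
  have hmeas : ∀ U : Set (BondConfig (Fin n)), MeasurableSet U := fun U => (Set.toFinite U).measurableSet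
  have hmarg : ∀ a ∈ A, (prodBernoulli (fdecouple c Z J v S w)).real (openConn o a) = (prodBernoulli w).real (openConn o a) :=
    fun a ha => real_openConn_fdecouple_eq H w A hangS hangZ hA ho ha
  have hsum' : (2 : ℝ) < ∑ a ∈ A, (prodBernoulli (fdecouple c Z J v S w)).real (openConn o a) := by
    rw [Finset.sum_congr rfl hmarg]; exact hsum
  have hcut' : ∀ a ∈ A, (prodBernoulli (fdecouple c Z J v S w)).real (openConn o a)ᶜ ≤ t := by
    intro a ha
    rw [probReal_compl_eq_one_sub (hmeas _), hmarg a ha, ← probReal_compl_eq_one_sub (hmeas _)]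
    exact hcut a ha
  exact real_card_le_one_le_hubFamily H w A hangS hangZ hA ho hAZ t hdom (fun a ha => hcut a (Finset.mem_inter.1 ha).1) (hfar' hsum' hcut')

end Family

end Block

end Quant

end Summit.CriticalPhenomena.PercolationContinuityZ3.Theorems
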